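import Literature.Analysis.FunctionSpaces.PoissonMeckeProofs
import Mathlib.MeasureTheory.Integral.Prod

/-!
# The Poisson perturbation (Margulis–Russo) formula, I: the one-point slice and the
# second-order expansion of a Poisson expectation in the total intensity

Helper file for the crux `QuadrupoleSelectionRule` (stmt-CriticalPhenomena-7029, informal) of
route `CardyFlipRusso` (sub-problem `CardyFormulaZ2`), line `Sketch`, stub W2
(`PoissonPerturbationFormula` of idea card `poisson-ward-insertion`: the annealed Russo formula
for the Poisson superposition leg L2 of the Voronoi hub — the derivative of a Poisson expectation
in the intensity is the expected insertion effect; G. Last, M. Penrose, *Lectures on the Poisson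
Process* (2017), Thm 19.1, the perturbation / Margulis–Russo formula). This first part supplies,
from Kingman's axioms as packaged in `Literature.Analysis.FunctionSpaces` (Poisson counts,
independence, and the Mecke equation proved there from them):

* configuration lemmas: a configuration with `N(E) = 0` is empty, the one-point configuration
  `{a} = PointConfig.ofFn (fun _ : Fin 1 => a)` (`= PointConfig.ofFn ![a]`), its counts, its
  measurable dependence on `a`, and "`c ∪ {a}` has one point iff `c ⊆ {a}`";
* elementary exponential bounds `|e^{-x} - 1 + x| ≤ x²`, `1 - e^{-x}(1 + x) ≤ x²` for `x ≥ 0`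
  (`|e^{-x} - 1| ≤ x` is `Literature.Probability.RandomPlanarGeometry.abs_exp_neg_sub_one_le`,
  re-derived inline where used to keep the imports topical);
* `restrict_setOf_count_univ_eq_one`: for a Poisson process `Q` with finite atomless intensity
  `μ`, the law of the configuration on `{N = 1}` is `e^{-μ(E)} · μ ∘ (a ↦ {a})⁻¹` — from the
  Mecke equation (`IsPoissonPointProcess.lintegral_lintegral_toMeasure_eq`, Last–Penrose Thm 4.1)
  applied to `1_A(c) 1{N(c) = 1}`: inserting `a` into `c` gives a one-point configuration iff
  `c ⊆ {a}`, an event of void probability `e^{-μ({a}ᶜ)} = e^{-μ(E)}` (the `N = 1` case of the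
  mixed binomial representation, Last–Penrose Prop. 3.5);
* `abs_integral_sub_le_of_isPoissonPointProcess`: for bounded measurable `Φ` (`|Φ| ≤ K`) and
  `x = μ(E)`, `|𝔼_Q Φ - e^{-x} Φ(∅) - e^{-x} ∫ Φ({a}) μ(da)| ≤ K x²` (split on `N = 0`, `N = 1`,
  `N ≥ 2`; the last event has probability `1 - e^{-x}(1 + x) ≤ x²`).

The derivative statement itself is in the sibling file
`CardyFlipRussoQuadrupoleSelectionRulePoissonPerturbation.lean`.
-/

noncomputable section

open MeasureTheory ProbabilityTheory Filter Set
open scoped ENNReal NNReal Topology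

namespace Summit.CriticalPhenomena.CardyFormulaZ2.Theorems

open Literature.Analysis.FunctionSpaces

section Config

variable {E : Type*} [TopologicalSpace E]

/-- A configuration with no point at all is the empty configuration. [folklore] -/
theorem eq_empty_of_count_univ_eq_zero {c : PointConfig E} (h : c.count univ = 0) :
    c = ∅ := by
  have h' : c.carrier = ∅ := by simpa [PointConfig.count] using h
  exact SetLike.ext' h'

/-- The empty configuration is a right unit for superposition: `c ∪ ∅ = c`. [folklore] -/
theorem union_empty_pointConfig (c : PointConfig E) : c ∪ (∅ : PointConfig E) = c :=
  SetLike.ext' (show (c ∪ (∅ : PointConfig E)).carrier = c.carrier by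
    rw [PointConfig.carrier_union, PointConfig.carrier_empty, Set.union_empty])

/-- The one-point configuration `{a}` (as `PointConfig.ofFn` of the constant `Fin 1`-family)
has carrier `{a}`. [folklore] -/
theorem carrier_ofFn_one (a : E) :
    (PointConfig.ofFn (fun _ : Fin 1 => a)).carrier = {a} := by
  rw [PointConfig.carrier_ofFn, Set.range_const]

/-- Counting a one-point configuration: `N_{{a}}(s) = 1{a ∈ s}`. [folklore] -/
theorem count_ofFn_one (a : E) (s : Set E) [Decidable (a ∈ s)] :
    (PointConfig.ofFn (fun _ : Fin 1 => a)).count s = if a ∈ s then 1 else 0 := by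
  rw [PointConfig.count, carrier_ofFn_one]
  split_ifs with h
  · rw [Set.inter_eq_left.2 (Set.singleton_subset_iff.2 h), Set.encard_singleton]
  · rw [Set.singleton_inter_eq_empty.2 h, Set.encard_empty]

/-- `Matrix` notation for the one-point family: `PointConfig.ofFn ![a]` is the one-point
configuration `PointConfig.ofFn (fun _ : Fin 1 => a)`. [folklore] -/
theorem ofFn_vec_one (a : E) :
    PointConfig.ofFn ![a] = PointConfig.ofFn (fun _ : Fin 1 => a) := by
  have h : (![a] : Fin 1 → E) = fun _ => a := funext fun i => Matrix.cons_val_fin_one a _ i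
  rw [h]

/-- A configuration has no point off `a` iff it is contained in `{a}`. [folklore] -/
theorem count_compl_singleton_eq_zero_iff (c : PointConfig E) (a : E) :
    c.count {a}ᶜ = 0 ↔ c.carrier ⊆ {a} := by
  rw [PointConfig.count, Set.encard_eq_zero, ← Set.sdiff_eq, Set.sdiff_eq_empty]

/-- Inserting `a` into `c` yields a one-point configuration iff `c ⊆ {a}`. [folklore] -/
theorem count_union_ofFn_one_univ_eq_one_iff (c : PointConfig E) (a : E) :
    (c ∪ PointConfig.ofFn (fun _ : Fin 1 => a)).count univ = 1 ↔ c.carrier ⊆ {a} := by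
  rw [PointConfig.count, PointConfig.carrier_union, carrier_ofFn_one, Set.inter_univ]
  constructor
  · intro h
    obtain ⟨x, hx⟩ := Set.encard_eq_one.1 h
    have hax : a = x := by
      have : a ∈ c.carrier ∪ {a} := Set.mem_union_right _ (Set.mem_singleton a)
      rw [hx] at this
      exact this
    subst hax
    rw [← hx]
    exact Set.subset_union_left
  · intro h
    rw [Set.union_eq_right.2 h, Set.encard_singleton]

/-- If `c ⊆ {a}` then inserting `a` into `c` gives exactly `{a}`. [folklore] -/
theorem union_ofFn_one_eq_of_subset {c : PointConfig E} {a : E} (h : c.carrier ⊆ {a}) :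
    c ∪ PointConfig.ofFn (fun _ : Fin 1 => a) = PointConfig.ofFn (fun _ : Fin 1 => a) :=
  SetLike.ext' (show (c ∪ PointConfig.ofFn (fun _ : Fin 1 => a)).carrier =
      (PointConfig.ofFn (fun _ : Fin 1 => a)).carrier by
    rw [PointConfig.carrier_union, carrier_ofFn_one]
    exact Set.union_eq_right.2 h)

variable [MeasurableSpace E]

/-- The one-point configuration depends measurably on its point: `a ↦ {a}` is measurable for
the count σ-algebra (its counting maps are indicators). [folklore] -/
theorem measurable_ofFn_one :
    Measurable fun a : E => PointConfig.ofFn (fun _ : Fin 1 => a) := by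
  classical
  refine PointConfig.measurable_of_count fun s hs => ?_
  simp_rw [count_ofFn_one]
  exact Measurable.ite hs measurable_const measurable_const

end Config

section Exp

/-- For `x ≥ 0`: `|e^{-x} - 1 + x| ≤ x²`. [folklore] -/
theorem abs_exp_neg_sub_one_add_le {x : ℝ} (hx : 0 ≤ x) :
    |Real.exp (-x) - 1 + x| ≤ x ^ 2 := by
  have h2 : -x + 1 ≤ Real.exp (-x) := Real.add_one_le_exp (-x)
  have h3 : x + 1 ≤ Real.exp x := Real.add_one_le_exp x
  have h4 : Real.exp (-x) * Real.exp x = 1 := by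
    rw [← Real.exp_add, neg_add_cancel, Real.exp_zero]
  have h5 : 0 < Real.exp (-x) := Real.exp_pos _
  have h6 : Real.exp (-x) * (x + 1) ≤ 1 :=
    (mul_le_mul_of_nonneg_left h3 h5.le).trans_eq h4
  have h7 : x * (1 - Real.exp (-x)) ≤ x * x :=
    mul_le_mul_of_nonneg_left (by linarith) hx
  rw [abs_le]
  constructor <;> nlinarith

/-- For `x ≥ 0`: `1 - e^{-x} - x e^{-x} ≤ x²` (the Poisson probability of at least two points
is at most the square of the mean). [folklore] -/
theorem one_sub_exp_neg_sub_mul_le {x : ℝ} (hx : 0 ≤ x) :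
    1 - Real.exp (-x) - Real.exp (-x) * x ≤ x ^ 2 := by
  have h2 : -x + 1 ≤ Real.exp (-x) := Real.add_one_le_exp (-x)
  nlinarith [mul_le_mul_of_nonneg_right h2 (by linarith : (0 : ℝ) ≤ x + 1)]

end Exp

section Poisson

variable {E : Type*} [TopologicalSpace E] [T2Space E] [SecondCountableTopology E]
  [MeasurableSpace E] [BorelSpace E]

/-- **The one-point slice of a finite atomless Poisson law.** For a Poisson point process `Q`
with finite atomless intensity `μ`, the law of the configuration on the event "exactly one
point" is `e^{-μ(E)}` times the image of `μ` under `a ↦ {a}`: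
`Q(A ∩ {N = 1}) = e^{-μ(E)} μ{a | {a} ∈ A}`. From the Mecke equation
(`IsPoissonPointProcess.lintegral_lintegral_toMeasure_eq`, Last–Penrose 2017 Thm 4.1) with
`f(c, a) = 1_A(c) 1{N(c) = 1}`: `c ∪ {a}` is a one-point configuration iff `c ⊆ {a}`, an event
of void probability `e^{-μ({a}ᶜ)} = e^{-μ(E)}` (cf. the mixed binomial representation,
Last–Penrose 2017 Prop. 3.5). [cite: LastPenrose2017, Prop 3.5] -/
theorem restrict_setOf_count_univ_eq_one {μ : Measure E} {Q : Measure (PointConfig E)}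
    (hQ : IsPoissonPointProcess μ Q) (hfin : μ univ ≠ ∞) (hμ : ∀ x, μ {x} = 0) :
    Q.restrict {c : PointConfig E | c.count univ = 1} =
      ENNReal.ofReal (Real.exp (-(μ univ).toReal)) •
        μ.map (fun a : E => PointConfig.ofFn (fun _ : Fin 1 => a)) := by
  classical
  haveI := hQ.isProbabilityMeasure
  haveI : IsFiniteMeasure μ := ⟨hfin.lt_top⟩
  have hg : Measurable fun a : E => PointConfig.ofFn (fun _ : Fin 1 => a) := measurable_ofFn_one
  have hA₁ : MeasurableSet {c : PointConfig E | c.count univ = 1} :=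
    PointConfig.measurable_count MeasurableSet.univ (measurableSet_singleton _)
  set C := ENNReal.ofReal (Real.exp (-(μ univ).toReal)) with hCdef
  have hvoid : ∀ a : E, Q {c : PointConfig E | c.count {a}ᶜ = 0} = C := fun a => by
    rw [hQ.measure_count_eq_zero (measurableSet_singleton a).compl (measure_ne_top μ _),
      measure_compl (measurableSet_singleton a) (by simp [hμ a]), hμ a, tsub_zero]
  ext s hs
  rw [Measure.restrict_apply hs, Measure.smul_apply, Measure.map_apply hg hs, smul_eq_mul]
  set A := s ∩ {c : PointConfig E | c.count univ = 1} with hAdef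
  have hA : MeasurableSet A := hs.inter hA₁
  have key := hQ.lintegral_lintegral_toMeasure_eq
    (f := fun p : PointConfig E × E => A.indicator (1 : PointConfig E → ℝ≥0∞) p.1)
    ((measurable_one.indicator hA).comp measurable_fst)
  -- the left-hand side of the Mecke equation is `Q A`
  have hL : ∀ c : PointConfig E,
      ∫⁻ _a, A.indicator (1 : PointConfig E → ℝ≥0∞) c ∂c.toMeasure = A.indicator 1 c := by
    intro c
    rw [lintegral_const, PointConfig.toMeasure_apply' c MeasurableSet.univ]
    by_cases hc : c ∈ A
    · have h1 : c.count univ = 1 := hc.2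
      rw [indicator_of_mem hc, h1, Pi.one_apply, one_mul]
      simp
    · rw [indicator_of_notMem hc, zero_mul]
  -- the right-hand side, pointwise in the inserted point
  have hR : ∀ a : E,
      ∫⁻ c, A.indicator (1 : PointConfig E → ℝ≥0∞) (c ∪ PointConfig.ofFn (fun _ : Fin 1 => a)) ∂Q =
        ((fun a : E => PointConfig.ofFn (fun _ : Fin 1 => a)) ⁻¹' s).indicator 1 a * C := by
    intro a
    have hpt : ∀ c : PointConfig E,
        A.indicator (1 : PointConfig E → ℝ≥0∞) (c ∪ PointConfig.ofFn (fun _ : Fin 1 => a)) =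
          {c : PointConfig E | c.count {a}ᶜ = 0}.indicator
            (fun _ => ((fun a : E => PointConfig.ofFn (fun _ : Fin 1 => a)) ⁻¹' s).indicator
              (1 : E → ℝ≥0∞) a) c := by
      intro c
      by_cases hc : c.carrier ⊆ {a}
      · have hmem : c ∈ {c : PointConfig E | c.count {a}ᶜ = 0} :=
          (count_compl_singleton_eq_zero_iff c a).2 hc
        rw [indicator_of_mem hmem, union_ofFn_one_eq_of_subset hc]
        have hone : PointConfig.ofFn (fun _ : Fin 1 => a) ∈
            {c : PointConfig E | c.count univ = 1} := by
          show (PointConfig.ofFn (fun _ : Fin 1 => a)).count univ = 1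
          rw [count_ofFn_one, if_pos (Set.mem_univ a)]
        by_cases hsa : PointConfig.ofFn (fun _ : Fin 1 => a) ∈ s
        · rw [indicator_of_mem (show PointConfig.ofFn (fun _ : Fin 1 => a) ∈ A from ⟨hsa, hone⟩),
            indicator_of_mem (show a ∈ (fun a : E => PointConfig.ofFn (fun _ : Fin 1 => a)) ⁻¹' s
              from hsa)]
          rfl
        · rw [indicator_of_notMem (fun h : PointConfig.ofFn (fun _ : Fin 1 => a) ∈ A => hsa h.1),
            indicator_of_notMem (fun h : a ∈ (fun a : E =>
              PointConfig.ofFn (fun _ : Fin 1 => a)) ⁻¹' s => hsa h)]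
      · have hnot : c ∉ {c : PointConfig E | c.count {a}ᶜ = 0} := fun h =>
          hc ((count_compl_singleton_eq_zero_iff c a).1 h)
        have hnotA : c ∪ PointConfig.ofFn (fun _ : Fin 1 => a) ∉ A := fun h =>
          hc ((count_union_ofFn_one_univ_eq_one_iff c a).1 h.2)
        rw [indicator_of_notMem hnotA, indicator_of_notMem hnot]
    have hB : MeasurableSet {c : PointConfig E | c.count {a}ᶜ = 0} :=
      PointConfig.measurable_count (measurableSet_singleton a).compl (measurableSet_singleton _)
    rw [lintegral_congr hpt, lintegral_indicator_const hB, hvoid a]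
  have hLint : ∫⁻ c, ∫⁻ _a, A.indicator (1 : PointConfig E → ℝ≥0∞) c ∂c.toMeasure ∂Q = Q A := by
    rw [lintegral_congr hL, lintegral_indicator_one hA]
  have hRint : ∫⁻ a, ∫⁻ c, A.indicator (1 : PointConfig E → ℝ≥0∞)
      (c ∪ PointConfig.ofFn (fun _ : Fin 1 => a)) ∂Q ∂μ =
        C * μ ((fun a : E => PointConfig.ofFn (fun _ : Fin 1 => a)) ⁻¹' s) := by
    rw [lintegral_congr hR, lintegral_mul_const C (measurable_one.indicator (hg hs)),
      lintegral_indicator_one (hg hs), mul_comm]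
  rw [← hLint, key, hRint]

/-- **Second-order expansion of a Poisson expectation in the total intensity.** For a Poisson
point process `Q` with finite atomless intensity `μ` of mass `x = μ(E)` and a bounded measurable
`Φ` (`|Φ| ≤ K`):
`|𝔼_Q Φ - (e^{-x} Φ(∅) + e^{-x} ∫ Φ({a}) μ(da))| ≤ K x²` —
empty configuration with probability `e^{-x}`, one `μ/x`-distributed point with probability
`x e^{-x}` (`restrict_setOf_count_univ_eq_one`), at least two points with probability
`1 - e^{-x}(1 + x) ≤ x²` (Last–Penrose 2017, Prop. 3.5 and the proof of Thm 19.1).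
[cite: LastPenrose2017, Thm 19.1] -/
theorem abs_integral_sub_le_of_isPoissonPointProcess {μ : Measure E}
    {Q : Measure (PointConfig E)} (hQ : IsPoissonPointProcess μ Q) (hfin : μ univ ≠ ∞)
    (hμ : ∀ x, μ {x} = 0) (Φ : PointConfig E → ℝ) (hΦm : StronglyMeasurable Φ) (K : ℝ)
    (hΦb : ∀ c, |Φ c| ≤ K) :
    |∫ c, Φ c ∂Q - (Real.exp (-(μ.real univ)) * Φ ∅ +
        Real.exp (-(μ.real univ)) * ∫ a, Φ (PointConfig.ofFn (fun _ : Fin 1 => a)) ∂μ)| ≤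
      K * (μ.real univ) ^ 2 := by
  classical
  haveI := hQ.isProbabilityMeasure
  haveI : IsFiniteMeasure μ := ⟨hfin.lt_top⟩
  have hres := restrict_setOf_count_univ_eq_one hQ hfin hμ
  have hg : Measurable fun a : E => PointConfig.ofFn (fun _ : Fin 1 => a) := measurable_ofFn_one
  have hQ0 : Q.real {c : PointConfig E | c.count univ = 0} = Real.exp (-(μ.real univ)) :=
    hQ.measureReal_count_eq_zero MeasurableSet.univ hfin
  set x := μ.real univ with hxdef
  have hx : 0 ≤ x := measureReal_nonneg
  set A₀ := {c : PointConfig E | c.count univ = 0} with hA₀def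
  set A₁ := {c : PointConfig E | c.count univ = 1} with hA₁def
  have hA₀m : MeasurableSet A₀ :=
    PointConfig.measurable_count MeasurableSet.univ (measurableSet_singleton _)
  have hA₁m : MeasurableSet A₁ :=
    PointConfig.measurable_count MeasurableSet.univ (measurableSet_singleton _)
  have hdisj : Disjoint A₀ A₁ := by
    rw [Set.disjoint_left]
    intro c h0 h1
    have h0' : c.count univ = 0 := h0
    have h1' : c.count univ = 1 := h1
    rw [h0'] at h1'
    exact zero_ne_one h1'
  -- the probabilities of the three events
  have hQ1 : Q.real A₁ = Real.exp (-x) * x := by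
    have h : Q A₁ = ENNReal.ofReal (Real.exp (-(μ univ).toReal)) * μ univ := by
      rw [← Measure.restrict_apply_univ (μ := Q) (s := A₁), hres, Measure.smul_apply,
        Measure.map_apply hg MeasurableSet.univ, Set.preimage_univ, smul_eq_mul]
    rw [measureReal_def, h, ENNReal.toReal_mul, ENNReal.toReal_ofReal (Real.exp_nonneg _),
      hxdef, measureReal_def]
  have hQ2 : Q.real (A₀ ∪ A₁)ᶜ = 1 - Real.exp (-x) - Real.exp (-x) * x := by
    rw [measureReal_compl (hA₀m.union hA₁m), measureReal_union hdisj hA₁m, hQ0, hQ1,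
      probReal_univ]
    ring
  -- the integrals
  have hK : 0 ≤ K := (abs_nonneg _).trans (hΦb ∅)
  have hΦi : Integrable Φ Q :=
    Integrable.of_bound hΦm.aestronglyMeasurable K
      (Eventually.of_forall fun c => by rw [Real.norm_eq_abs]; exact hΦb c)
  have hJ : ∫ c in A₁, Φ c ∂Q =
      Real.exp (-x) * ∫ a, Φ (PointConfig.ofFn (fun _ : Fin 1 => a)) ∂μ := by
    rw [hres, integral_smul_measure, integral_map_of_stronglyMeasurable hg hΦm,
      ENNReal.toReal_ofReal (Real.exp_nonneg _), smul_eq_mul, hxdef, measureReal_def]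
  -- pointwise decomposition of `Φ` along the three events
  set D : PointConfig E → ℝ := fun c =>
    Φ c - A₀.indicator (fun _ => Φ ∅) c - A₁.indicator Φ c with hDdef
  have hDb : ∀ c, ‖D c‖ ≤ (A₀ ∪ A₁)ᶜ.indicator (fun _ => K) c := by
    intro c
    rw [Real.norm_eq_abs]
    by_cases h0 : c ∈ A₀
    · have hc : c = ∅ := eq_empty_of_count_univ_eq_zero h0
      have h1 : c ∉ A₁ := Set.disjoint_left.1 hdisj h0
      have hD0 : D c = 0 := by
        simp only [hDdef, indicator_of_mem h0, indicator_of_notMem h1]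
        rw [hc]
        ring
      rw [hD0, abs_zero]
      exact Set.indicator_nonneg (fun _ _ => hK) _
    · by_cases h1 : c ∈ A₁
      · have hD0 : D c = 0 := by
          simp only [hDdef, indicator_of_notMem h0, indicator_of_mem h1]
          ring
        rw [hD0, abs_zero]
        exact Set.indicator_nonneg (fun _ _ => hK) _
      · have hc : c ∈ (A₀ ∪ A₁)ᶜ := fun h => h.elim h0 h1
        simp only [hDdef, indicator_of_notMem h0, indicator_of_notMem h1, indicator_of_mem hc,
          sub_zero]
        exact hΦb c
  have hi0 : Integrable (A₀.indicator fun _ => Φ ∅) Q := (integrable_const _).indicator hA₀m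
  have hi1 : Integrable (A₁.indicator Φ) Q := hΦi.indicator hA₁m
  have hDint : ∫ c, D c ∂Q =
      ∫ c, Φ c ∂Q - Q.real A₀ * Φ ∅ - ∫ c in A₁, Φ c ∂Q := by
    simp only [hDdef]
    have hi2 : Integrable (fun c => Φ c - A₀.indicator (fun _ => Φ ∅) c) Q := hΦi.sub hi0
    rw [integral_sub hi2 hi1, integral_sub hΦi hi0, integral_indicator_const _ hA₀m,
      integral_indicator hA₁m, smul_eq_mul]
  have hDle : ‖∫ c, D c ∂Q‖ ≤ K * Q.real (A₀ ∪ A₁)ᶜ := by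
    have hi3 : Integrable ((A₀ ∪ A₁)ᶜ.indicator fun _ => K) Q :=
      (integrable_const K).indicator (hA₀m.union hA₁m).compl
    have h := norm_integral_le_of_norm_le hi3 (Eventually.of_forall hDb)
    rw [integral_indicator_const _ (hA₀m.union hA₁m).compl, smul_eq_mul, mul_comm] at h
    exact h
  rw [Real.norm_eq_abs, hDint, hQ0, hJ, hQ2] at hDle
  calc |∫ c, Φ c ∂Q - (Real.exp (-x) * Φ ∅ +
          Real.exp (-x) * ∫ a, Φ (PointConfig.ofFn (fun _ : Fin 1 => a)) ∂μ)|
        = |∫ c, Φ c ∂Q - Real.exp (-x) * Φ ∅ -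
            Real.exp (-x) * ∫ a, Φ (PointConfig.ofFn (fun _ : Fin 1 => a)) ∂μ| := by
          congr 1
          ring
    _ ≤ K * (1 - Real.exp (-x) - Real.exp (-x) * x) := hDle
    _ ≤ K * x ^ 2 := mul_le_mul_of_nonneg_left (one_sub_exp_neg_sub_mul_le hx) hK

end Poisson

end Summit.CriticalPhenomena.CardyFormulaZ2.Theorems

end
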